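import Literature.Topology.FourManifolds.CorkDecompositionMatveyevForm
import Literature.Topology.FourManifolds.HCobordismTheoremProofs
import HarnessLib

/-!
# Matveyev's printed form of the cork decomposition theorem from its current frontier

Topic `Literature/Topology/FourManifolds` (fact seat
`provefact-Literature.Topology.FourManifolds.Matveyev1996_decomposition`; bookkeeping companion
of `CorkDecompositionMatveyevForm.lean` and `CorkTwistProofs.lean`).

`Literature.Topology.FourManifolds.Matveyev1996_decomposition` (`CorkDecomposition.lean` §2) is
Matveyev's Theorem 1 (J. Differential Geom. 44 (1996); arXiv:dg-ga/9505001, p. 1) in its printed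
two-piece form, parts 1–2 minus the `H₂` clause.  `CorkDecompositionMatveyevForm.lean` proves it
from Milnor's Thm. 8.1 at one end of the 5-dimensional h-cobordism, the middle level (B) and the
four-dimensional construction (H4) (`matveyev1996_decomposition_of_middleLevel`), and
`CorkTwistProofs.lean` from the then frontier L3 ∧ L8 ∧ (B) ∧ (H4).  Since then the
h-cobordism DAG has moved (`HCobordismTheoremProofs.lean`): Lemma 8.3 in `V₂₊` (L8,
`Cobordism.Milnor1965_exists_idealCircle_holds`) is a theorem of the tree, and Assertion 6 of the
proof of the First Cancellation Theorem 5.4 (L3) follows from the one leaf of Milnor's proof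
below it that is still a named fact, the deformation of the level diffeomorphism `h`
(`Literature.Topology.FourManifolds.Cobordism.Milnor1965_cancellation_levelDeformation`,
`HCobordismLevelIsotopy.lean`; Milnor 1965, proof of Thm. 5.4, PDF pp. 31–32 with Thm. 5.6),
whence Thm. 8.1 at one end
(`Cobordism.Milnor1965_exists_isMorseFunction_two_le_index_left_of_levelDeformation`).

This file records the resulting residual of the printed form — **three named facts**:

| leaf | source | tree name |
|---|---|---|
| LD | Milnor 1965, proof of Thm. 5.4, Assertion 6 (PDF pp. 31–32), Thm. 5.6 | `Cobordism.Milnor1965_cancellation_levelDeformation` (`HCobordismLevelIsotopy.lean`) |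
| (B) | Kirby 1996 §2 (last par.); Matveyev, Proof of Theorem, sentences 1–6 | `exists_dualSpheres_middleLevel_of_two_three` (`CorkDecompositionMiddleLevel.lean`) |
| (H4) | Matveyev pp. 1–3 with Fact 1; Kirby 1996 §3, Addenda (B), (C) | `Matveyev1996_partOne_and_fact_of_dualSpheres` (`CorkDecompositionMiddleLevel.lean`) |

* `Literature.Topology.FourManifolds.matveyev1996_decomposition_of_levelDeformation` —
  `Matveyev1996_decomposition ⟸ LD ∧ (B) ∧ (H4)`;
* `Literature.Topology.FourManifolds.corkDecomposition_of_levelDeformation` — the same for the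
  one-piece form `Literature.Topology.FourManifolds.corkDecomposition`.

Of (H4), the differential topology of Matveyev's step 3 (the common exterior `M := cl(N ∖ V₃)`
and the decompositions `Mᵢ = M #_Σ Wᵢ`) is proved in `SurgeryRegularDomain.lean`; what remains
named is the construction of `V₃`, the contractibility of `W₁`, `W₂` and Fact 1.  When the three
leaves are discharged, `Matveyev1996_decomposition_holds` is
`matveyev1996_decomposition_of_levelDeformation` applied to the three `_holds`.  No statement is
introduced here.

## References

* R. Matveyev, *A decomposition of smooth simply-connected h-cobordant 4-manifolds*,
  J. Differential Geom. 44 (1996) 571–582; arXiv:dg-ga/9505001: Theorem 1 (p. 1) and its proof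
  (pp. 1–3). [Matveyev1996]
* R. Kirby, *Akbulut's corks and h-cobordisms of smooth, simply connected 4-manifolds*, Turkish
  J. Math. 20 (1996) 85–93; arXiv:math/9712231, §§2–4. [KirbyCorks1996]
* J. Milnor, *Lectures on the h-cobordism theorem*, Princeton (1965): proof of Thm. 5.4,
  Assertion 6 (PDF pp. 31–32), Thm. 5.6 (PDF pp. 32–36), Thm. 8.1 and its proof
  (PDF pp. 54–57). [MilnorHCobordism1965]
-/

noncomputable section

namespace Literature.Topology.FourManifolds

universe u

/-- **Matveyev's Theorem 1 (parts 1–2 minus the `H₂` clause) from its current frontier**: the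
deformation of the level diffeomorphism in the proof of Milnor's Thm. 5.4 (LD,
`Literature.Topology.FourManifolds.Cobordism.Milnor1965_cancellation_levelDeformation`), the middle level of the
two-three handlebody (B) (`Literature.Topology.FourManifolds.exists_dualSpheres_middleLevel_of_two_three`) and the
four-dimensional construction in the middle level (H4)
(`Literature.Topology.FourManifolds.Matveyev1996_partOne_and_fact_of_dualSpheres`), by
`matveyev1996_decomposition_of_middleLevel` with Thm. 8.1 at one end taken from LD
(`Cobordism.Milnor1965_exists_isMorseFunction_two_le_index_left_of_levelDeformation`, which
uses the discharged ideal circle `Cobordism.Milnor1965_exists_idealCircle_holds`).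
[cite: Matveyev1996, Theorem 1 and its proof (arXiv pp. 1–3)]
[cite: MilnorHCobordism1965, Thm. 8.1 and its proof (PDF pp. 54–57), proof of Thm. 5.4 (PDF pp. 31–32)] -/
theorem matveyev1996_decomposition_of_levelDeformation
    (hLD : Cobordism.Milnor1965_cancellation_levelDeformation.{u})
    (hB : exists_dualSpheres_middleLevel_of_two_three.{u})
    (h4 : Matveyev1996_partOne_and_fact_of_dualSpheres.{u}) : Matveyev1996_decomposition.{u} :=
  matveyev1996_decomposition_of_middleLevel
    (Cobordism.Milnor1965_exists_isMorseFunction_two_le_index_left_of_levelDeformation hLD) hB h4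

/-- **The cork decomposition theorem (one-piece form) from the same three leaves**, through the
printed form (`corkDecomposition_of_matveyev1996`). [cite: Matveyev1996, Theorem 1]
[cite: KirbyCorks1996, Theorem and Addenda (B)–(D)] -/
theorem corkDecomposition_of_levelDeformation
    (hLD : Cobordism.Milnor1965_cancellation_levelDeformation.{u})
    (hB : exists_dualSpheres_middleLevel_of_two_three.{u})
    (h4 : Matveyev1996_partOne_and_fact_of_dualSpheres.{u}) : corkDecomposition.{u} :=
  corkDecomposition_of_matveyev1996 (matveyev1996_decomposition_of_levelDeformation hLD hB h4)

end Literature.Topology.FourManifolds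

end
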